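import Summits.Ventures.PercRepro.SevenThreeDualClosure
import Summits.Ventures.PercRepro.SevenThreeLineTerm
import Summits.Ventures.PercRepro.SevenThreeLineCount
import Summits.Ventures.PercRepro.SevenThreeStarGuard

/-!
# PercRepro — the `(7,3)` cell: the witnesses of a line fibre (p3, gen 16)

Fix a LINE of the dual: `λ ⊆ E` with `drk λ = 2` and `dcl λ = λ` (`SevenThreeDualClosure.lean`). A witness
`S = E ∖ Z` with `Z ⊆ λ ∩ W` and `drk Z = 2` has nullity one, its cyclic part is the circuit `C = E ∖ λ`
(`line_witness_data`), its coloops are `λ ∖ Z`, and its bracket is Lemma 24.1's term of `SevenThreeLineTerm.lean`: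
`Lc · bracket T (W ∖ Z) = Lc / DlineN (|λ| − |Z|) (7 − |Z|) − Lc·[x ≤ 3]/C(x+3, 3)` (`bracket_line_eq`), the line
table's `bracketN` with `k = |λ ∩ T|`, `L = |(λ ∩ W) ∖ L₀|`, `sz = |Z ∖ L₀|`, `zl = |Z ∩ L₀|`. Also the datum facts
`|λ ∩ T| ≤ 2` and `|λ ∩ W| ≤ 5` when the fibre is nonempty (`line_datum_bounds`: the circuit meets `T` and has
two points of `W`). (`P3-C025-seven-three-plan.md` §9 (R3)(a).)
-/

namespace PercRepro

namespace SevenThree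

open Finset ThmH SixThree

variable {α : Type*} [DecidableEq α] {M : Matroid α} [M.Finite]

/-- The coloops of the world lie in every dual closure. -/
theorem coloops_subset_dcl {T W Z : Finset α} (h : ReducedWorld M T W) :
    coloopsOf M (T ∪ W) ⊆ dcl M T W Z := by
  intro e he
  rw [mem_dcl]
  refine ⟨coloopsOf_subset M _ he, ?_⟩
  by_cases heZ : e ∈ Z
  · rw [Finset.insert_eq_of_mem heZ]
  · have := drk_union_coloops (world_subset h) (V := Z) (Y := {e}) (Finset.singleton_subset_iff.2 he)
      (Finset.disjoint_singleton_right.2 heZ)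
    rw [Finset.union_comm Z {e}, ← Finset.insert_eq] at this
    exact this

/-- **The data of a line witness**: for a line `λ` (`drk λ = 2`, `dcl λ = λ`) and `Z ⊆ λ ∩ W` with `drk Z = 2`, the
witness `S = T ∪ (W ∖ Z)` has nullity one, `|S| + |Z| = 10`, cyclic part `E ∖ λ` and coloops `λ ∖ Z`. -/
theorem line_witness_data {T W lam Z : Finset α} (h : ReducedWorld M T W) (hr : M.eRank = 7)
    (hlamE : lam ⊆ T ∪ W) (hlam2 : drk M (T ∪ W) lam = 2) (hlamcl : dcl M T W lam = lam)
    (hZ : Z ⊆ lam ∩ W) (hZ2 : drk M (T ∪ W) Z = 2) :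
    nrk M (T ∪ (W \ Z)) + 1 = (T ∪ (W \ Z)).card ∧ (T ∪ (W \ Z)).card + Z.card = 10 ∧
      cyclicPart M (T ∪ (W \ Z)) = (T ∪ W) \ lam ∧ coloopsOf M (T ∪ (W \ Z)) = lam \ Z := by
  have hZW : Z ⊆ W := hZ.trans Finset.inter_subset_right
  have hZlam : Z ⊆ lam := hZ.trans Finset.inter_subset_left
  have hZE : Z ⊆ T ∪ W := hZW.trans Finset.subset_union_right
  have hsd : (T ∪ W) \ Z = T ∪ (W \ Z) := by
    have := world_sdiff_eq h (X := W \ Z) Finset.sdiff_subset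
    rw [Finset.sdiff_sdiff_eq_self hZW] at this
    exact this
  have hdcl : dcl M T W Z = lam := by
    rw [dcl_eq_of_subset hlamE (by rw [hlamcl]; exact hZlam) (by rw [hZ2, hlam2]), hlamcl]
  have hcyc : cyclicPart M (T ∪ (W \ Z)) = (T ∪ W) \ lam := by
    rw [← hsd, cyclicPart_sdiff_eq h hr, hdcl]
  refine ⟨?_, ?_, hcyc, ?_⟩
  · have h1 := nrk_witness_add_three h hr (X := W \ Z) Finset.sdiff_subset
    rw [Finset.sdiff_sdiff_eq_self hZW, hZ2] at h1
    omega
  · rw [Finset.card_union_of_disjoint (h.disj.mono_right Finset.sdiff_subset), Finset.card_sdiff_of_subset hZW,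
      h.T_card, h.W_card]
    have := Finset.card_le_card hZW
    rw [h.W_card] at this
    omega
  · have h1 := cyclicPart_union_coloopsOf (M := M) (T ∪ (W \ Z))
    have h2 := disjoint_cyclicPart_coloopsOf (M := M) (T ∪ (W \ Z))
    rw [hcyc] at h1 h2
    ext e
    constructor
    · intro he
      have heS : e ∈ T ∪ (W \ Z) := coloopsOf_subset M _ he
      rw [← hsd, Finset.mem_sdiff] at heS
      rw [Finset.mem_sdiff]
      refine ⟨?_, heS.2⟩
      by_contra hlam
      exact Finset.disjoint_left.1 h2 (Finset.mem_sdiff.2 ⟨heS.1, hlam⟩) he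
    · intro he
      rw [Finset.mem_sdiff] at he
      have heS : e ∈ T ∪ (W \ Z) := by
        rw [← hsd, Finset.mem_sdiff]
        exact ⟨hlamE he.1, he.2⟩
      rw [← h1, Finset.mem_union] at heS
      rcases heS with hh | hh
      · exact absurd (Finset.mem_sdiff.1 hh).2 (fun hn => hn he.1)
      · exact hh

/-- The cyclic part of a nullity-one set is a circuit (Mathlib's `IsCircuit`), and the points outside it are
coloops. -/
theorem cyclicPart_isCircuit_of_nullity_one {S : Finset α} (hS : S ⊆ gr M) (hnul : nrk M S + 1 = S.card) :
    M.IsCircuit ((cyclicPart M S : Finset α) : Set α) ∧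
      ∀ y ∈ S, y ∉ cyclicPart M S → y ∉ M.closure ((S.erase y : Finset α) : Set α) := by
  have hnul' : M.eRk (S : Set α) + 1 = (S.card : ℕ∞) := by
    rw [← coe_nrk, ← hnul]
    push_cast
    rfl
  obtain ⟨C, hCS, hC, hcol⟩ := exists_circuit_of_nullity_one hS hnul'
  have hCeq : cyclicPart M S = C := by
    ext e
    rw [mem_cyclicPart]
    constructor
    · rintro ⟨heS, hcl⟩
      by_contra heC
      exact hcol e heS heC hcl
    · intro heC
      refine ⟨hCS heC, ?_⟩
      have := hC.mem_closure_sdiff_singleton_of_mem (Finset.mem_coe.2 heC)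
      apply M.closure_subset_closure _ this
      intro x hx
      rw [Set.mem_sdiff, Set.mem_singleton_iff, Finset.mem_coe] at hx
      rw [Finset.mem_coe, Finset.mem_erase]
      exact ⟨hx.2, hCS hx.1⟩
  rw [hCeq]
  exact ⟨hC, hcol⟩

/-- **The bracket of a line witness** (`Z ⊆ λ ∩ W`, `drk Z = 2`, `3 ≤ |Z|`): Lemma 24.1's term with `a = |λ| − |Z|`,
`x = 7 − |Z|`. -/
theorem bracket_line_eq {T W lam Z : Finset α} (h : ReducedWorld M T W) (hr : M.eRank = 7)
    (hlamE : lam ⊆ T ∪ W) (hlam2 : drk M (T ∪ W) lam = 2) (hlamcl : dcl M T W lam = lam)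
    (hZ : Z ⊆ lam ∩ W) (hZ2 : drk M (T ∪ W) Z = 2) (hZ3 : 3 ≤ Z.card) :
    bracket M T (W \ Z) = 1 / ((LineTable.DlineN (lam.card - Z.card) (7 - Z.card) : ℤ) : ℚ) -
      (if 7 - Z.card ≤ 3 then 1 / (((7 - Z.card + 3).choose 3 : ℕ) : ℚ) else 0) := by
  obtain ⟨hnul, hcard10, hcyc, hcol⟩ := line_witness_data h hr hlamE hlam2 hlamcl hZ hZ2
  have hZW : Z ⊆ W := hZ.trans Finset.inter_subset_right
  have hZlam : Z ⊆ lam := hZ.trans Finset.inter_subset_left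
  have hSg : T ∪ (W \ Z) ⊆ gr M := Finset.union_subset h.T_sub (Finset.sdiff_subset.trans h.W_sub)
  obtain ⟨hC, hcolo⟩ := cyclicPart_isCircuit_of_nullity_one hSg hnul
  have hXcard : (W \ Z).card = 7 - Z.card := by rw [Finset.card_sdiff_of_subset hZW, h.W_card]
  have hZ7 : Z.card ≤ 7 := by have := Finset.card_le_card hZW; rw [h.W_card] at this; exact this
  -- `|C| ≥ 3`: `C` is dependent in a simple matroid
  have hCcard : (cyclicPart M (T ∪ (W \ Z))).card + (coloopsOf M (T ∪ (W \ Z))).card = (T ∪ (W \ Z)).card :=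
    card_cyclicPart_add _
  have hCrk := eRk_cyclicPart_add hSg
  rw [← coe_nrk, ← coe_nrk] at hCrk
  have hCrk' : nrk M (cyclicPart M (T ∪ (W \ Z))) + (coloopsOf M (T ∪ (W \ Z))).card = nrk M (T ∪ (W \ Z)) := by
    exact_mod_cast hCrk
  have hdep : nrk M (cyclicPart M (T ∪ (W \ Z))) < (cyclicPart M (T ∪ (W \ Z))).card := by omega
  have hCE : cyclicPart M (T ∪ (W \ Z)) ⊆ T ∪ W :=
    (cyclicPart_subset M _).trans (Finset.union_subset_union (Finset.Subset.refl T) Finset.sdiff_subset)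
  have hc3 := three_le_card_of_dep h hCE hdep
  have hnul' : M.eRk ((T ∪ (W \ Z) : Finset α) : Set α) + 1 = ((T ∪ (W \ Z)).card : ℕ∞) := by
    rw [← coe_nrk, ← hnul]
    push_cast
    rfl
  have hne : W \ Z ≠ ∅ := by
    intro hh
    rw [hh, Finset.union_empty] at hnul
    have := nrk_subset_T h (Finset.Subset.refl T)
    omega
  have hx2 : 2 ≤ (W \ Z).card := two_le_card_of_nullity_one h Finset.sdiff_subset hne hnul'
  have hx4 : (W \ Z).card ≤ 4 := by omega
  have hlam10 : ((T ∪ W) \ lam).card + lam.card = 10 := by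
    rw [Finset.card_sdiff_of_subset hlamE, card_world h]
    have := Finset.card_le_card hlamE
    rw [card_world h] at this
    omega
  rw [bracket_of_nullity_one h Finset.sdiff_subset hnul' (cyclicPart_subset M _) hC hc3 hcolo hx2 hx4]
  have harg : (W \ Z).card + 3 - (cyclicPart M (T ∪ (W \ Z))).card = lam.card - Z.card := by
    rw [hcyc, hcol, Finset.card_sdiff_of_subset hZlam] at hCcard
    rw [hcyc, hXcard]
    omega
  rw [harg, hXcard]

end SevenThree

end PercRepro
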